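import Summits.Schanuel.Schanuel.Theorems.RootDecomp1KHyper67

/-!
# RootDecomp1KHyper — lens 6, generation 17 «BILOG STAIRCASE CELL» (BilogStair.lean edition 5 aca95ecc…, 4212 l; §N–§O) — continuation (RootDecomp1KHyper68): §N the assembly `innerNormII_of_pieces : ConjDataII → NonVanishII → InnerNormII` (PROVED; single exponent `c' = max (max c₂ c₃) c₄` uniform in `k`) and `transferII_of_conjData`

(lens-6 g17 `BilogStair.lean` EDITION 5, sha256 aca95ecc…629b, 4212 l, own farm rc 0 · 0 warn · 0 sorry · axioms std; §A–§M = editions 2–4 (ported as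
`RootDecomp1KHyper53`–`66`), §N–§O appended in edition 5 (NODE/EDITION5 L1783, statement diff 0 removed / 0 changed / 36 added; critic ACK L1789: additive,
verified symbol by symbol, PORT may proceed FROM ed.5 as one edition); port by census-1 gen 16 in parts `RootDecomp1KHyper67`–`69` — 67 = §N `ConjDataII` (Prop def,
UNDECIDED), `toPolyT`, `resT`, `NonVanishII` (Prop def), product formula `aeval_resT`, `resT_zero`, `norm_resT_le`, `plen`, `resT_bounds`; 68 = §N `innerNormII_of_pieces :
ConjDataII → NonVanishII → InnerNormII` (PROVED; one exponent uniform in k) + `transferII_of_conjData`; 69 = §O `specXY`, `sliceT`, `exists_root_slice_eq_zero`,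
`nonVanishII_holds : NonVanishII` (PROVED), `transferII_of_conjDataII : ConjDataII → TransferII`. PORT edits: eight generic one-liners private (per-part copies);
sixteen one-line docstrings added; statements and proofs otherwise verbatim. INSTRUMENTS of record, NO credit (critic L1789: TransferII is REDUCED to ConjDataII alone;
`conjDataII_holds` ⇒ TransferII proved as typed ⇒ ONE THEOREM credit on arrival; cell credit needs TransferI + member package). `--supports stmt-Schanuel-33363`; rung 0.)
-/

open Complex Polynomial IntermediateField Filter
open scoped BigOperators

namespace Summit.Schanuel.Schanuel.Theorems.RootDecomp1KHyper

namespace HyperCell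

namespace LatCell

namespace Bilog

variable {n : ℕ}
open Summit.Schanuel.Schanuel.Theorems.RootDecomp1KRelLiouvilleCell (mvPolyMeasure_one_of_polyMeasure ycoeff
  mvaeval_cons_eq_sum mvlen_ycoeff_le natDegree_finSuccEquiv_le_totalDegree norm_mvaeval_le_mvlen_mul_pow)

section InnerRes

/-- `plen f ≥ 0`. -/
private theorem plen_nonneg (f : ℤ[X]) : 0 ≤ plen f := Finset.sum_nonneg fun _ _ => abs_nonneg _

/-- **INNER NORM from conjugate data and non-vanishing (PROVED).**  With `N_k := Res_T(f_k, G)`: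
non-vanishing = `NonVanishII`; degree `≤ (d_k + n)·deg G`, length `≤ (d_k+n)! (plen f_k + mvlen G)^{d_k+n}`
(`resT_bounds`), value bound (`norm_resT_le` at radius `R_k = exp(H^c)(π+|ℓ|+1)H`), zero structure
(`resT_zero`) — all `≤ H^{c'}` / `≤ exp(H^{c'})` eventually by the `PB` calculus.  The SINGLE exponent
is `c' := max (max c₂ c₃) c₄` of the three `PB` exponents (degree / length / value), each obtained from the
`ConjDataII` exponent `c`, `deg G` and `mvlen G` alone — uniform in `k` (the `∃ c` sits outside every `∀ᶠ k`). -/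
theorem innerNormII_of_pieces (hCD : ConjDataII) (hNV : NonVanishII) : InnerNormII := by
  classical
  intro ℓ a b halg hdeg hb G hG
  obtain ⟨f, c, hf0, hfγ, hconj, hfdeg, hfcoef, hfroot⟩ := hCD ℓ a b halg
  have hNV' := hNV ℓ a b hdeg G hG
  -- constants of `G`
  obtain ⟨D, hD⟩ : ∃ D : ℕ, D = G.totalDegree := ⟨_, rfl⟩
  obtain ⟨n, hn⟩ : ∃ n : ℕ, n = (toPolyT G).natDegree := ⟨_, rfl⟩
  have hnD : n ≤ D := by rw [hn, hD]; exact natDegree_toPolyT_le G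
  obtain ⟨LG, hLG⟩ : ∃ LG : ℝ, LG = ((mvlen G : ℤ) : ℝ) := ⟨_, rfl⟩
  have hLG1 : 1 ≤ LG := by rw [hLG]; exact_mod_cast one_le_mvlen hG
  have hLG0 : 0 ≤ LG := by linarith
  have hH3 : ∀ k, (3 : ℝ) ≤ hgt a b k := three_le_hgt a b
  have hH1 : ∀ k, (1 : ℝ) ≤ hgt a b k := fun k => by linarith [hH3 k]
  have hD0 : (0 : ℝ) ≤ (D : ℝ) := Nat.cast_nonneg D
  have hn0 : (0 : ℝ) ≤ (n : ℝ) := Nat.cast_nonneg n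
  -- the degrees `d_k`
  obtain ⟨dk, hdk⟩ : ∃ dk : ℕ → ℝ, dk = fun k => ((f k).natDegree : ℝ) := ⟨_, rfl⟩
  have hdkk : ∀ k, dk k = ((f k).natDegree : ℝ) := fun k => by rw [hdk]
  have hdkPB : PB a b dk := pb_of_le (pb_pow_hgt c) (hfdeg.mono fun k hk => by rw [hdkk]; exact hk)
  have hdk0 : ∀ k, 0 ≤ dk k := fun k => by rw [hdkk]; exact Nat.cast_nonneg _
  -- (ii) degree
  have hdegPB : PB a b fun k => (((resT (f k) G).totalDegree : ℕ) : ℝ) := by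
    refine pb_of_le (pb_mul (pb_add hdkPB (pb_const (D : ℝ))) (pb_const (D : ℝ))
      (Filter.Eventually.of_forall fun k => by linarith [hdk0 k])
      (Filter.Eventually.of_forall fun _ => hD0)) (Filter.Eventually.of_forall fun k => ?_)
    have h := (resT_bounds (f k) G).2
    rw [← hn, ← hD] at h
    rw [hdkk]
    calc ((resT (f k) G).totalDegree : ℝ) ≤ ((((f k).natDegree + n) * D : ℕ) : ℝ) := by exact_mod_cast h
      _ = (((f k).natDegree : ℝ) + n) * D := by push_cast; ring
      _ ≤ (((f k).natDegree : ℝ) + D) * D := by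
          apply mul_le_mul_of_nonneg_right _ hD0
          have : (n : ℝ) ≤ D := by exact_mod_cast hnD
          linarith
  obtain ⟨c₂, hc₂⟩ := hdegPB
  -- (iii) length
  have hBk : ∀ᶠ k in atTop, ((plen (f k) : ℤ) : ℝ) ≤ (dk k + 1) * Real.exp (hgt a b k ^ c) := by
    filter_upwards [hfcoef] with k hk
    rw [hdkk]
    unfold plen
    push_cast
    calc ∑ i ∈ (f k).support, |((f k).coeff i : ℝ)| ≤ ∑ i ∈ (f k).support, Real.exp (hgt a b k ^ c) :=
          Finset.sum_le_sum fun i _ => hk i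
      _ = ((f k).support.card : ℝ) * Real.exp (hgt a b k ^ c) := by rw [Finset.sum_const, nsmul_eq_mul]
      _ ≤ (((f k).natDegree : ℝ) + 1) * Real.exp (hgt a b k ^ c) := by
          apply mul_le_mul_of_nonneg_right _ (Real.exp_pos _).le
          exact_mod_cast Polynomial.card_supp_le_succ_natDegree (f k)
  obtain ⟨F, hF⟩ : ∃ F : ℕ → ℝ,
      F = fun k => (dk k + n) * (dk k + n) + (dk k + n) * ((dk k + 1 + LG) + hgt a b k ^ c) := ⟨_, rfl⟩
  have hFPB : PB a b F := by
    rw [hF]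
    have h1 : PB a b fun k => dk k + n := pb_add hdkPB (pb_const _)
    have h1' : ∀ᶠ k in atTop, 0 ≤ dk k + n := Filter.Eventually.of_forall fun k => by linarith [hdk0 k]
    refine pb_add (pb_mul h1 h1 h1' h1') (pb_mul h1 (pb_add (pb_add (pb_add hdkPB (pb_const 1))
      (pb_const LG)) (pb_pow_hgt c)) h1' ?_)
    exact Filter.Eventually.of_forall fun k => by
      linarith [hdk0 k, pow_nonneg (by linarith [hH3 k] : (0 : ℝ) ≤ hgt a b k) c]
  have hlen : ∀ᶠ k in atTop, ((mvlen (resT (f k) G) : ℤ) : ℝ) ≤ Real.exp (F k) := by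
    filter_upwards [hBk] with k hk
    have h := (resT_bounds (f k) G).1
    rw [← hn] at h
    have hpl0 : (0 : ℝ) ≤ ((plen (f k) : ℤ) : ℝ) := by exact_mod_cast plen_nonneg (f k)
    have hB1 : (1 : ℝ) ≤ ((plen (f k) : ℤ) : ℝ) + LG := by linarith
    have hBpos : (0 : ℝ) < ((plen (f k) : ℤ) : ℝ) + LG := by linarith
    obtain ⟨m, hm⟩ : ∃ m : ℕ, m = (f k).natDegree + n := ⟨_, rfl⟩
    have hmR : (m : ℝ) = dk k + n := by rw [hm, hdkk]; push_cast; ring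
    rw [← hm] at h
    have hlogB : Real.log (((plen (f k) : ℤ) : ℝ) + LG) ≤ (dk k + 1 + LG) + hgt a b k ^ c := by
      have he1 : (1 : ℝ) ≤ Real.exp (hgt a b k ^ c) := Real.one_le_exp (pow_nonneg (by linarith [hH3 k]) c)
      have hle : ((plen (f k) : ℤ) : ℝ) + LG ≤ (dk k + 1 + LG) * Real.exp (hgt a b k ^ c) := by
        nlinarith [hk, hLG0, he1]
      have hpos2 : (0 : ℝ) < dk k + 1 + LG := by linarith [hdk0 k]
      calc Real.log (((plen (f k) : ℤ) : ℝ) + LG) ≤ Real.log ((dk k + 1 + LG) * Real.exp (hgt a b k ^ c)) :=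
            Real.log_le_log hBpos hle
        _ = Real.log (dk k + 1 + LG) + hgt a b k ^ c := by
            rw [Real.log_mul hpos2.ne' (Real.exp_pos _).ne', Real.log_exp]
        _ ≤ (dk k + 1 + LG) + hgt a b k ^ c := by linarith [Real.log_le_self hpos2.le]
    calc ((mvlen (resT (f k) G) : ℤ) : ℝ) ≤ ((Nat.factorial m : ℤ) : ℝ) * (((plen (f k) : ℤ) : ℝ) + LG) ^ m := by
          rw [hLG]; exact_mod_cast h
      _ ≤ Real.exp ((m : ℝ) * m) * Real.exp ((m : ℝ) * ((dk k + 1 + LG) + hgt a b k ^ c)) := by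
          apply mul_le_mul _ _ (pow_nonneg hBpos.le _) (Real.exp_pos _).le
          · calc ((Nat.factorial m : ℤ) : ℝ) = (Nat.factorial m : ℝ) := by norm_cast
              _ ≤ ((m ^ m : ℕ) : ℝ) := by exact_mod_cast Nat.factorial_le_pow m
              _ = (m : ℝ) ^ m := by push_cast; ring
              _ ≤ Real.exp (m : ℝ) ^ m :=
                  pow_le_pow_left₀ (Nat.cast_nonneg _) (by linarith [Real.add_one_le_exp (m : ℝ)]) m
              _ = Real.exp ((m : ℝ) * m) := by rw [← Real.exp_nat_mul]
          · calc (((plen (f k) : ℤ) : ℝ) + LG) ^ m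
                = Real.exp (Real.log (((plen (f k) : ℤ) : ℝ) + LG)) ^ m := by rw [Real.exp_log hBpos]
              _ = Real.exp ((m : ℝ) * Real.log (((plen (f k) : ℤ) : ℝ) + LG)) := by rw [← Real.exp_nat_mul]
              _ ≤ Real.exp ((m : ℝ) * ((dk k + 1 + LG) + hgt a b k ^ c)) :=
                  Real.exp_le_exp.mpr (mul_le_mul_of_nonneg_left hlogB (Nat.cast_nonneg _))
      _ = Real.exp (F k) := by rw [← Real.exp_add, hF]; dsimp only; rw [hmR]
  obtain ⟨c₃, hc₃⟩ := hFPB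
  -- (iv) value bound
  obtain ⟨Lb, hLb⟩ : ∃ Lb : ℕ → ℝ,
      Lb = fun k => LG + D * (hgt a b k ^ c + (Real.pi + |ℓ| + 1) * hgt a b k) := ⟨_, rfl⟩
  obtain ⟨E, hE⟩ : ∃ E : ℕ → ℝ, E = fun k => n * hgt a b k ^ c + dk k * Lb k := ⟨_, rfl⟩
  have hpl1 : (1 : ℝ) ≤ Real.pi + |ℓ| + 1 := by linarith [Real.pi_pos, abs_nonneg ℓ]
  have hLbPB : PB a b Lb := by
    rw [hLb]
    refine pb_add (pb_const LG) (pb_mul (pb_const _) (pb_add (pb_pow_hgt c) (pb_mul (pb_const _) pb_hgt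
      (Filter.Eventually.of_forall fun _ => by linarith) (Filter.Eventually.of_forall fun k => by
        linarith [hH3 k]))) (Filter.Eventually.of_forall fun _ => hD0)
      (Filter.Eventually.of_forall fun k => ?_))
    exact add_nonneg (pow_nonneg (by linarith [hH3 k]) c) (mul_nonneg (by linarith) (by linarith [hH3 k]))
  have hLb0 : ∀ k, 0 ≤ Lb k := fun k => by
    rw [hLb]
    have hq : 0 ≤ (Real.pi + |ℓ| + 1) * hgt a b k := mul_nonneg (by linarith) (by linarith [hH3 k])
    exact add_nonneg hLG0 (mul_nonneg hD0 (add_nonneg (pow_nonneg (by linarith [hH3 k]) c) hq))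
  have hEPB : PB a b E := by
    rw [hE]
    exact pb_add (pb_mul (pb_const _) (pb_pow_hgt c) (Filter.Eventually.of_forall fun _ => hn0)
      (Filter.Eventually.of_forall fun k => pow_nonneg (by linarith [hH3 k]) c))
      (pb_mul hdkPB hLbPB (Filter.Eventually.of_forall hdk0) (Filter.Eventually.of_forall hLb0))
  have hval : ∀ᶠ k in atTop,
      ‖MvPolynomial.aeval ![(Real.pi : ℂ), (a k : ℂ) * Real.pi + (b k : ℂ) * ℓ] (resT (f k) G)‖ ≤
        Real.exp (E k) *
          ‖MvPolynomial.aeval ![(Real.pi : ℂ), (a k : ℂ) * Real.pi + (b k : ℂ) * ℓ, gam ℓ a b k] G‖ := by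
    filter_upwards [hfcoef, hfroot] with k hkc hkr
    have hHk := hH3 k
    have hHc0 : (0 : ℝ) ≤ hgt a b k ^ c := pow_nonneg (by linarith) c
    obtain ⟨R, hR⟩ : ∃ R : ℝ, R = Real.exp (hgt a b k ^ c) * ((Real.pi + |ℓ| + 1) * hgt a b k) := ⟨_, rfl⟩
    have he1 : (1 : ℝ) ≤ Real.exp (hgt a b k ^ c) := Real.one_le_exp hHc0
    have hq1 : (1 : ℝ) ≤ (Real.pi + |ℓ| + 1) * hgt a b k := by nlinarith
    have hR1 : 1 ≤ R := by rw [hR]; nlinarith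
    have hRq : (Real.pi + |ℓ| + 1) * hgt a b k ≤ R := by rw [hR]; nlinarith
    have hRe : Real.exp (hgt a b k ^ c) ≤ R := by rw [hR]; nlinarith
    have hx : ‖(Real.pi : ℂ)‖ ≤ R := by
      rw [Complex.norm_real, Real.norm_eq_abs, abs_of_pos Real.pi_pos]
      nlinarith [abs_nonneg ℓ, Real.pi_pos]
    have hy : ‖(a k : ℂ) * Real.pi + (b k : ℂ) * ℓ‖ ≤ R := by
      have hab := abs_cast_le_hgt a b k
      have hpt : (a k : ℂ) * Real.pi + (b k : ℂ) * ℓ = ((((a k : ℝ) * Real.pi + (b k : ℝ) * ℓ : ℝ)) : ℂ) := by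
        push_cast; ring
      rw [hpt, Complex.norm_real, Real.norm_eq_abs]
      calc |(a k : ℝ) * Real.pi + (b k : ℝ) * ℓ| ≤ |(a k : ℝ) * Real.pi| + |(b k : ℝ) * ℓ| := abs_add_le _ _
        _ = |(a k : ℝ)| * Real.pi + |(b k : ℝ)| * |ℓ| := by
            rw [abs_mul, abs_mul, abs_of_pos Real.pi_pos]
        _ ≤ hgt a b k * Real.pi + hgt a b k * |ℓ| := by
            nlinarith [hab.1, hab.2, Real.pi_pos, abs_nonneg ℓ, abs_nonneg (a k : ℝ), abs_nonneg (b k : ℝ)]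
        _ ≤ (Real.pi + |ℓ| + 1) * hgt a b k := by nlinarith
        _ ≤ R := hRq
    have hroots' : ∀ z : ℂ, Polynomial.aeval z (f k) = 0 → ‖z‖ ≤ R := fun z hz => (hkr z hz).trans hRe
    have h := norm_resT_le (hf0 k) hG (hfγ k) hR1 hx hy hroots'
    rw [← hn, ← hD, ← hLG] at h
    refine h.trans ?_
    -- the factor
    have hlc : |((f k).leadingCoeff : ℝ)| ≤ Real.exp (hgt a b k ^ c) := by
      rw [Polynomial.leadingCoeff]; exact hkc _
    have h1 : |((f k).leadingCoeff : ℝ)| ^ n ≤ Real.exp ((n : ℝ) * hgt a b k ^ c) := by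
      rw [Real.exp_nat_mul]; exact pow_le_pow_left₀ (abs_nonneg _) hlc n
    have hM1 : (1 : ℝ) ≤ LG * R ^ D := by nlinarith [one_le_pow₀ (M₀ := ℝ) hR1 (n := D)]
    have hMpos : (0 : ℝ) < LG * R ^ D := by linarith
    have hlogR : Real.log R ≤ hgt a b k ^ c + (Real.pi + |ℓ| + 1) * hgt a b k := by
      rw [hR, Real.log_mul (Real.exp_pos _).ne' (by positivity), Real.log_exp]
      linarith [Real.log_le_self (by positivity : (0 : ℝ) ≤ (Real.pi + |ℓ| + 1) * hgt a b k)]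
    have hlogM : Real.log (LG * R ^ D) ≤ Lb k := by
      rw [hLb]; dsimp only
      rw [Real.log_mul (by linarith) (pow_pos (by linarith) _).ne', Real.log_pow]
      have := Real.log_le_self hLG0
      nlinarith [hlogR, hD0, Real.log_nonneg hR1]
    have h2 : (LG * R ^ D) ^ ((f k).natDegree - 1) ≤ Real.exp (dk k * Lb k) := by
      calc (LG * R ^ D) ^ ((f k).natDegree - 1) ≤ (LG * R ^ D) ^ (f k).natDegree :=
            pow_le_pow_right₀ hM1 (Nat.sub_le _ _)
        _ = Real.exp (Real.log (LG * R ^ D)) ^ (f k).natDegree := by rw [Real.exp_log hMpos]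
        _ = Real.exp (((f k).natDegree : ℝ) * Real.log (LG * R ^ D)) := by rw [← Real.exp_nat_mul]
        _ ≤ Real.exp (dk k * Lb k) := by
            rw [hdkk]
            exact Real.exp_le_exp.mpr (mul_le_mul_of_nonneg_left hlogM (Nat.cast_nonneg _))
    calc |((f k).leadingCoeff : ℝ)| ^ n * ((LG * R ^ D) ^ ((f k).natDegree - 1) *
          ‖MvPolynomial.aeval ![(Real.pi : ℂ), (a k : ℂ) * Real.pi + (b k : ℂ) * ℓ, gam ℓ a b k] G‖)
        ≤ Real.exp ((n : ℝ) * hgt a b k ^ c) * (Real.exp (dk k * Lb k) *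
          ‖MvPolynomial.aeval ![(Real.pi : ℂ), (a k : ℂ) * Real.pi + (b k : ℂ) * ℓ, gam ℓ a b k] G‖) :=
          mul_le_mul h1 (mul_le_mul_of_nonneg_right h2 (norm_nonneg _))
            (mul_nonneg (pow_nonneg hMpos.le _) (norm_nonneg _)) (Real.exp_pos _).le
      _ = Real.exp (E k) *
          ‖MvPolynomial.aeval ![(Real.pi : ℂ), (a k : ℂ) * Real.pi + (b k : ℂ) * ℓ, gam ℓ a b k] G‖ := by
          rw [← mul_assoc, ← Real.exp_add, hE]
  obtain ⟨c₄, hc₄⟩ := hEPB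
  -- assemble with one exponent
  refine ⟨fun k => resT (f k) G, max (max c₂ c₃) c₄, ?_, ?_, ?_, ?_, ?_⟩
  · exact hNV'.mono fun k hk => hk (f k) (hf0 k) (hfγ k) (hconj k)
  · filter_upwards [hc₂] with k hk
    exact hk.trans (pow_le_pow_right₀ (hH1 k) (le_max_of_le_left (le_max_left _ _)))
  · filter_upwards [hlen, hc₃] with k h1 h2
    exact h1.trans (Real.exp_le_exp.mpr (h2.trans (pow_le_pow_right₀ (hH1 k)
      (le_max_of_le_left (le_max_right _ _)))))
  · filter_upwards [hval, hc₄] with k h1 h2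
    exact h1.trans (mul_le_mul_of_nonneg_right (Real.exp_le_exp.mpr (h2.trans (pow_le_pow_right₀ (hH1 k)
      (le_max_right _ _)))) (norm_nonneg _))
  · exact Filter.Eventually.of_forall fun k x₂ h0 => by
      obtain ⟨z, hz, hGz⟩ := resT_zero (hf0 k) G h0
      exact ⟨z, hconj k z hz, hGz⟩

/-- Hence **TRANSFER II ⟸ CONJUGATE DATA ∧ NON-VANISHING** (PROVED reduction). -/
theorem transferII_of_conjData (hCD : ConjDataII) (hNV : NonVanishII) : TransferII :=
  transferII_of_innerNorm (innerNormII_of_pieces hCD hNV)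

end InnerRes

end Bilog
end LatCell
end HyperCell
end Summit.Schanuel.Schanuel.Theorems.RootDecomp1KHyper
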